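import Mathlib
import Summits.HodgeConjecture.FermatCycles.HodgeFermatPropDPrimeNA

/-!
# PROPOSITION D′(3N) and THE DESCENT — part 2: the divisibility form and the converse `units39_lift` (`HodgeFermat/PropDPrimeN.lean`; HF-G34)

Tree copy (part 2 of 2) of the module `HodgeFermat/PropDPrimeN.lean` of the sibling cell's standalone package
`run/shared/lean/pub/pub-hodgefermat/lean/HodgeFermat/` (398 lines, sha256 `adb67a1bc7bcf667…`), source lines 297–398 (§§3–4: `primeFactors_ge`, `noCoincidence′`, the converse `units39_facts`, `units39_disjoint`, `units39_lift`).
Filed by cell `pub-hfermat`, seat prover-1 gen-3, on the COORDINATOR KEEPER RULING of 2026-08-25 (gem sweep H1: take the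
off-gate kernel theorem `thmFstar` through the gate) — here THEOREM F* of `tables/DPRIME-THEOREM.md` §9 IN FULL, i.e.
PROPOSITION D′(3N) and the descent (`HodgeFermat/PropDPrimeNFinal.lean`, GATE HF-G34), the last off-gate form of THEOREM F*
(its first two forms, `DecodingFinal.thmFstar` = F* at the prime levels and `ThmFstarNFinal.thmFstar` = F*(3N), landed on
2026-08-25 as `HodgeFermatThmFstar.lean` / `HodgeFermatThmFstarN.lean`, seats prover-1 gen-0 / gen-2); this file is one link of
the import closure of `PropDPrimeNFinal.propDprime` (the sibling's KR-free chain: THEOREM L, COROLLARY M, THEOREM D6,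
THEOREM U⁺, THEOREM KR6, THEOREM Z3U) on top of those landed chains.  The source module is the sibling's hub-checked module of
record (pub-hodgefermat `CERT.md` l.990, GATE HF-G34); its declarations are copied VERBATIM.
Deviations from the source module, exhaustively: the `import` lines (tree modules `Summits.HodgeConjecture.FermatCycles.
HodgeFermat*` instead of `HodgeFermat.*`); this module docstring; the `set_option`/namespace/`open` preamble (source l.41–48) is repeated at the top because the module is split; DEDUP (pre-empting the gate's `dedup.landed`): the source's `theorem sameType_lift` (l.332–347) restates `HodgeFermat.KRFree.FiveZ3Z1.sameType_scale` of `HodgeFermatFiveZ3Z1.lean` (imported through `HodgeFermatThreeFinal`) VERBATIM up to names and is DELETED, re-bound by the added line `open HodgeFermat.KRFree.FiveZ3Z1 renaming sameType_scale → sameType_lift` so that its use (source l.396) stays byte-identical. The module docstring is quoted in full in part 1.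
Every other line — in particular every declaration's statement and proof — is byte-identical to the source.
HONEST FRAMING: explicit algebraic cycles for specific Hodge classes on Fermat/Delsarte varieties; residual open instances
listed; no claim on general Hodge.  (This file is arithmetic of CM types / finite combinatorics / analytic number theory
of the sibling's KR-free programme; it claims nothing about cycles.)
-/

set_option autoImplicit false

namespace HodgeFermat.KRFree.PropDPrimeN

open HodgeFermat.KRFree.LemmaN
open HodgeFermat.KRFree.TheoremUEq (ThmUPlus' Perm3)
open HodgeFermat.KRFree.TheoremZ3U (KR6')
open HodgeFermat.KRFree.CoincFull (classes39 InClass fullAt_39)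

open HodgeFermat.KRFree.FiveZ3Z1 renaming sameType_scale → sameType_lift

/-! ### Divisibility form and a worked level -/

/-- the hypothesis "all prime factors `≥ 11`" in divisibility form -/
lemma primeFactors_ge {N : ℕ} (h2 : ¬ 2 ∣ N) (h3 : ¬ 3 ∣ N) (h5 : ¬ 5 ∣ N) (h7 : ¬ 7 ∣ N) :
    ∀ p ∈ N.primeFactors, 11 ≤ p := by
  intro p hp
  obtain ⟨hpr, hdvd, -⟩ := Nat.mem_primeFactors.mp hp
  by_contra hlt
  have hlt' : p < 11 := by omega
  interval_cases p <;>
    first | exact absurd hpr (by decide) | exact h2 hdvd | exact h3 hdvd | exact h5 hdvd | exact h7 hdvd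

/-- `noCoincidence` with the hypotheses on `N` in divisibility form: `N` squarefree, prime to `210`, `13 ∤ N`. -/
theorem noCoincidence' (hKR : KR6') (hUplus : ThmUPlus') (hF : Fstar) {N : ℕ} (hN : 0 < N) (hsq : Squarefree N)
    (h2 : ¬ 2 ∣ N) (h3 : ¬ 3 ∣ N) (h5 : ¬ 5 ∣ N) (h7 : ¬ 7 ∣ N) (h13 : ¬ 13 ∣ N) {a b c a' b' c' : ℕ}
    (hs : 3 * N ∣ a + b + c) (ha : ¬ 3 * N ∣ a) (hb : ¬ 3 * N ∣ b) (hc : ¬ 3 * N ∣ c)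
    (hs' : 3 * N ∣ a' + b' + c') (ha' : ¬ 3 * N ∣ a') (hb' : ¬ 3 * N ∣ b') (hc' : ¬ 3 * N ∣ c')
    (hD : ∀ u v, (u = a ∨ u = b ∨ u = c) → (v = a' ∨ v = b' ∨ v = c') → ¬ u ≡ v [MOD 3 * N])
    (hH : SameType (3 * N) (a, b, c) (a', b', c')) : False :=
  noCoincidence hKR hUplus hF hN hsq (primeFactors_ge h2 h3 h5 h7) h13 hs ha hb hc hs' ha' hb' hc' hD hH

/-- A WORKED LEVEL: `m = 561 = 3·11·17` (the least level `3N` of the theorem with `N` composite and `13 ∤ N`): no two disjoint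
zero-sum triples mod `561` with no entry `≡ 0` have the same CM type — whatever their common factors with `561`. -/
example (hKR : KR6') (hUplus : ThmUPlus') (hF : Fstar) {a b c a' b' c' : ℕ}
    (hs : 3 * 187 ∣ a + b + c) (ha : ¬ 3 * 187 ∣ a) (hb : ¬ 3 * 187 ∣ b) (hc : ¬ 3 * 187 ∣ c)
    (hs' : 3 * 187 ∣ a' + b' + c') (ha' : ¬ 3 * 187 ∣ a') (hb' : ¬ 3 * 187 ∣ b') (hc' : ¬ 3 * 187 ∣ c')
    (hD : ∀ u v, (u = a ∨ u = b ∨ u = c) → (v = a' ∨ v = b' ∨ v = c') → ¬ u ≡ v [MOD 3 * 187])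
    (hH : SameType (3 * 187) (a, b, c) (a', b', c')) : False :=
  have hsq : Squarefree (11 * 17) :=
    (Nat.squarefree_mul (by norm_num)).mpr ⟨(show Nat.Prime 11 by norm_num).squarefree, (show Nat.Prime 17 by norm_num).squarefree⟩
  noCoincidence' hKR hUplus hF (by norm_num) hsq (by norm_num) (by norm_num) (by norm_num) (by norm_num) (by norm_num)
    hs ha hb hc hs' ha' hb' hc' hD hH

/-! ## 4. The converse direction: multiples of a coincidence are coincidences -/


/-- kernel facts about the two unit classes used by the lift: zero sum `39 ∣ x + y + z` and entries in `[1, 38]` -/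
theorem units39_facts : ∀ cl ∈ units39, ∀ T ∈ cl,
    39 ∣ T.1 + T.2.1 + T.2.2 ∧ 0 < T.1 ∧ T.1 < 39 ∧ 0 < T.2.1 ∧ T.2.1 < 39 ∧ 0 < T.2.2 ∧ T.2.2 < 39 := by decide

/-- kernel fact: distinct members of a unit class have pairwise distinct entries -/
theorem units39_disjoint : ∀ cl ∈ units39, ∀ T ∈ cl, ∀ T' ∈ cl, T ≠ T' → ¬ Share T T' := by decide

/-- **THE CONVERSE IN FULL.**  For every `g > 0` and every pair of distinct triples `T ≠ T′` in one of the two unit classes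
`units39`, the multiples `g·T`, `g·T′` form a disjoint coincidence at level `3·(13·g)`: zero sums, no entry `≡ 0`, disjoint
mod `39g`, same CM type.  With `descent` this is THEOREM F\* of `tables/DPRIME-THEOREM.md` §9 as an exact description: at a
squarefree level `3N` with all primes of `N ≥ 11` the disjoint coincidences are precisely the `(N/13)`-multiples of the twelve
level-39 unit pairs. -/
theorem units39_lift {g : ℕ} (hg : 0 < g) {cl : List CoincFull.Tri} (hcl : cl ∈ units39) {x y z x' y' z' : ℕ}
    (hT : (x, y, z) ∈ cl) (hT' : (x', y', z') ∈ cl) (hne : (x, y, z) ≠ (x', y', z')) :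
    3 * (13 * g) ∣ g * x + g * y + g * z ∧ ¬ 3 * (13 * g) ∣ g * x ∧ ¬ 3 * (13 * g) ∣ g * y ∧ ¬ 3 * (13 * g) ∣ g * z ∧
    3 * (13 * g) ∣ g * x' + g * y' + g * z' ∧ ¬ 3 * (13 * g) ∣ g * x' ∧ ¬ 3 * (13 * g) ∣ g * y' ∧ ¬ 3 * (13 * g) ∣ g * z' ∧
    (∀ u v, (u = g * x ∨ u = g * y ∨ u = g * z) → (v = g * x' ∨ v = g * y' ∨ v = g * z') → ¬ u ≡ v [MOD 3 * (13 * g)]) ∧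
    SameType (3 * (13 * g)) (g * x, g * y, g * z) (g * x', g * y', g * z') := by
  have e : 3 * (13 * g) = g * 39 := by ring
  obtain ⟨hs, hx0, hx, hy0, hy, hz0, hz⟩ := units39_facts cl hcl _ hT
  obtain ⟨hs', hx0', hx', hy0', hy', hz0', hz'⟩ := units39_facts cl hcl _ hT'
  have hd := units39_disjoint cl hcl _ hT _ hT' hne
  have hST : SameType 39 (x, y, z) (x', y', z') := CoincFull.classes39_sameType (units39_sub cl hcl) hT hT'
  dsimp only at hs hx0 hx hy0 hy hz0 hz hs' hx0' hx' hy0' hy' hz0' hz'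
  -- an entry `w ∈ [1, 38]` times `g` is not a multiple of `39g`, and is `< 39g`
  have lt : ∀ w, w < 39 → g * w < 3 * (13 * g) := fun w hw => by
    rw [e]; exact Nat.mul_lt_mul_of_pos_left hw hg
  have nd : ∀ w, 0 < w → w < 39 → ¬ 3 * (13 * g) ∣ g * w := fun w hw0 hw hdvd =>
    absurd (Nat.le_of_dvd (Nat.mul_pos hg hw0) hdvd) (not_le.mpr (lt w hw))
  have zs : ∀ p q r, 39 ∣ p + q + r → 3 * (13 * g) ∣ g * p + g * q + g * r := fun p q r h => by
    rw [e, show g * p + g * q + g * r = g * (p + q + r) by ring]; exact mul_dvd_mul_left g h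
  refine ⟨zs _ _ _ hs, nd _ hx0 hx, nd _ hy0 hy, nd _ hz0 hz, zs _ _ _ hs', nd _ hx0' hx', nd _ hy0' hy', nd _ hz0' hz',
    ?_, ?_⟩
  · -- disjointness: a congruence between entries `< 39g` is an equality, and `g` cancels
    intro u v hu hv huv
    have hu' : u < 3 * (13 * g) := by
      rcases hu with rfl | rfl | rfl
      exacts [lt _ hx, lt _ hy, lt _ hz]
    have hv' : v < 3 * (13 * g) := by
      rcases hv with rfl | rfl | rfl
      exacts [lt _ hx', lt _ hy', lt _ hz']
    have huv' : u = v := by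
      have h := huv; unfold Nat.ModEq at h; rwa [Nat.mod_eq_of_lt hu', Nat.mod_eq_of_lt hv'] at h
    apply hd
    unfold Share; dsimp only
    rcases hu with rfl | rfl | rfl <;> rcases hv with rfl | rfl | rfl <;>
      have hh := Nat.eq_of_mul_eq_mul_left hg huv' <;> omega
  · rw [e]; exact sameType_lift hg hST

end HodgeFermat.KRFree.PropDPrimeN
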